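import Summits.ValiantsHypothesis.ValiantsHypothesis.Theorems.LacunarySymmetroidMatrixDescartesDoorA26WallBubblingBubblingExtendedCount

/-!
# Extended real exponential sums: the ROBUST Laguerre–Pólya count (convergent approximants on a fixed slot set) — line `wall_bubbling`, W4 (file 5)

Helper for the line `Cruxes/DoorA26/Lines/wall_bubbling.lean` (stmt-ValiantsHypothesis-19979), obligations (W)/(M): target of record W4 #5 (line lead val-idea-15 g3
W-TARGETS FINAL, desk R2680): «ROBUST EXTENDED COUNT — convergent approximants of `Σ_w P_w(t)e^{wt}` on a fixed slot set, some limit slot `≠ 0` ⇒ eventually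
`≤ Σ_{P_w≠0}(deg P_w + 1) − 1` zeros per window» = the «level bookkeeping» input of W2's reduction `ConfluentDoor26 ⇒ Stmt.weylFaces_generic` and of the
(M) third-level objects.  Seat val-sym-lift-p1 (g19), W4; `--supports stmt-ValiantsHypothesis-19979 --as helper`.
CURRENCY (inline, no definition).  A MONOMIAL-EXTENDED sum of degree `≤ D` on an index type `ι`: coefficient ARRAY `c : ι → ℕ → ℝ` (vanishing beyond `D`),
exponents `x : ι → ℝ`, `g(t) = Σᵢ Σ_{k ≤ D} c i k · t^k · e^{xᵢ t}`.  Along `ν → ∞`: `c ν i k → c₀ i k`, `x ν i → x₀ i`.  The LIMIT SLOT POLYNOMIALS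
`Q w = Σ_{i : x₀ i = w} Σ_{k ≤ D} (c₀ i k) X^k` (indices with the same limit exponent MERGE) are passed as an opaque `Q : ℝ → ℝ[X]` with its defining
equation.  Proved here (no multiplicities, no Hurwitz; Rolle + compactness only):
* `hasDerivAt_monoExt_twist` — `d/dt Σᵢₖ c i k t^k e^{(xᵢ−v)t} = Σᵢₖ c′ i k t^k e^{(xᵢ−v)t}` with the TWISTED-DERIVATIVE ARRAY
  `c′ i k = (k+1)·c i (k+1) + (xᵢ − v)·c i k` (same degree bound, same exponents);
* `card_zeros_monoExt_step` — one `(d/dt − v)` step costs at most one zero in any window (the chain's `rolle_count`);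
* `classPoly_step` — the limit slot polynomials of the stepped array are `(Q w)′ + (w − v)·Q w` (so the slot count `Σ_{Q w ≠ 0}(deg + 1)` drops by one
  when `v` is an active class: `slots_derivative_lt`, `natDegree_derivative_add_C_mul` of `…BubblingExtendedCount`);
* `monoExt_eq_sum_classes`, `eventually_noZero_monoExt` — class regrouping of the limit and the zero-free-limit transfer on a compact window;
* **`robust_extSum_count`** — if some limit slot polynomial is non-zero and `Σ_{w ∈ V, Q w ≠ 0} (natDegree (Q w) + 1) ≤ N + 1` (`V ⊇` active classes),
  then for every window `[−R, R]` and all large `ν`, every finite zero set of `g_ν` in the window has `≤ N` elements.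
  (`D = 0` is the chain's B3 `robust_term_count`; the static count is `extSum_card_zeros_le`.)
HONEST FRAMING.  Classical real analysis (Laguerre's twisted Rolle, robust form); a counting TOOL for the LINE stubs (W)/(M), which remain OPEN;
nothing here bears on `DoorA26`, `MatrixDescartes` (stmt-18050) or VP ≠ VNP.  No definitions.
-/

-- `Summit.ValiantsHypothesis.ValiantsHypothesis.…` repeats a component by the D-0017 layout (single-conjunct summit); the name is mandated.
set_option linter.dupNamespace false
set_option autoImplicit false

namespace Summit.ValiantsHypothesis.ValiantsHypothesis.Theorems.LacunarySymmetroidMatrixDescartes.WallBubbling.Bubbling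

open Finset Filter Topology Polynomial

variable {ι : Type*} [Fintype ι]

/-! ## 1. The twisted derivative of a monomial-extended sum -/

/-- derivative of one monomial-exponential term: `d/dt [c t^k e^{ut}] = c(k t^{k−1} + u t^k) e^{ut}`, written with `t^{k-1}·k` as
`k * t^(k-1)`. [folklore] -/
theorem hasDerivAt_monomial_exp (c u : ℝ) (k : ℕ) (t : ℝ) :
    HasDerivAt (fun s => c * s ^ k * Real.exp (u * s)) (c * ((k : ℝ) * t ^ (k - 1)) * Real.exp (u * t) + c * t ^ k * (Real.exp (u * t) * u)) t := by
  have h1 : HasDerivAt (fun s => c * s ^ k) (c * ((k : ℝ) * t ^ (k - 1))) t := (hasDerivAt_pow k t).const_mul c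
  have h2 : HasDerivAt (fun s => Real.exp (u * s)) (Real.exp (u * t) * u) t := by
    have := ((hasDerivAt_id' t).const_mul u).exp
    simpa using this
  exact h1.mul h2

/-- **twisted derivative of a monomial-extended sum**: with `c′ i k = (k+1)·c i (k+1) + (xᵢ − v)·c i k` and `c i k = 0` for `k > D`,
`d/dt Σᵢ Σ_{k≤D} c i k t^k e^{(xᵢ−v)t} = Σᵢ Σ_{k≤D} c′ i k t^k e^{(xᵢ−v)t}`. [this file] -/
theorem hasDerivAt_monoExt_twist (D : ℕ) (c : ι → ℕ → ℝ) (x : ι → ℝ) (v : ℝ) (hD : ∀ i k, D < k → c i k = 0) (t : ℝ) :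
    HasDerivAt (fun s => ∑ i, ∑ k ∈ range (D + 1), c i k * s ^ k * Real.exp ((x i - v) * s))
      (∑ i, ∑ k ∈ range (D + 1), (((k : ℝ) + 1) * c i (k + 1) + (x i - v) * c i k) * t ^ k * Real.exp ((x i - v) * t)) t := by
  have hterm : ∀ i, HasDerivAt (fun s => ∑ k ∈ range (D + 1), c i k * s ^ k * Real.exp ((x i - v) * s))
      (∑ k ∈ range (D + 1), (((k : ℝ) + 1) * c i (k + 1) + (x i - v) * c i k) * t ^ k * Real.exp ((x i - v) * t)) t := by
    intro i
    have h := HasDerivAt.fun_sum (u := range (D + 1)) (A := fun k s => c i k * s ^ k * Real.exp ((x i - v) * s))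
      (A' := fun k => c i k * ((k : ℝ) * t ^ (k - 1)) * Real.exp ((x i - v) * t) + c i k * t ^ k * (Real.exp ((x i - v) * t) * (x i - v)))
      (x := t) (fun k _ => hasDerivAt_monomial_exp (c i k) (x i - v) k t)
    refine h.congr_deriv ?_
    -- reindex: `Σ_k c_k k t^{k-1} = Σ_k (k+1) c_{k+1} t^k` (the `k = 0` term vanishes, the top term `c_{D+1} = 0`)
    have hshift : ∑ k ∈ range (D + 1), c i k * ((k : ℝ) * t ^ (k - 1)) * Real.exp ((x i - v) * t) =
        ∑ k ∈ range (D + 1), ((k : ℝ) + 1) * c i (k + 1) * t ^ k * Real.exp ((x i - v) * t) := by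
      rw [Finset.sum_range_succ' (fun k => c i k * ((k : ℝ) * t ^ (k - 1)) * Real.exp ((x i - v) * t))]
      simp only [Nat.cast_zero, zero_mul, mul_zero, add_zero, Nat.cast_succ, Nat.add_sub_cancel]
      rw [Finset.sum_range_succ, hD i (D + 1) (by omega)]
      simp only [zero_mul, mul_zero, add_zero]
      exact Finset.sum_congr rfl fun k _ => by ring
    rw [Finset.sum_add_distrib, hshift, ← Finset.sum_add_distrib]
    exact Finset.sum_congr rfl fun k _ => by ring
  exact HasDerivAt.fun_sum (fun i _ => hterm i)

/-- untwisting: `Σᵢₖ c i k t^k e^{(xᵢ − v)t} = e^{−vt}·Σᵢₖ c i k t^k e^{xᵢt}`. [bookkeeping] -/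
theorem monoExt_twist_eq (D : ℕ) (c : ι → ℕ → ℝ) (x : ι → ℝ) (v t : ℝ) :
    ∑ i, ∑ k ∈ range (D + 1), c i k * t ^ k * Real.exp ((x i - v) * t) =
      Real.exp (-(v * t)) * ∑ i, ∑ k ∈ range (D + 1), c i k * t ^ k * Real.exp (x i * t) := by
  rw [Finset.mul_sum]
  refine Finset.sum_congr rfl fun i _ => ?_
  rw [Finset.mul_sum]
  refine Finset.sum_congr rfl fun k _ => ?_
  rw [sub_mul, Real.exp_sub, Real.exp_neg]
  ring

/-- **ONE STEP COSTS ONE ZERO**: if `g` (array `c`) vanishes on a finite `Z ⊆ [A, B]`, then the stepped sum (array `c′`) vanishes on a finite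
`Z' ⊆ [A, B]` with `#Z ≤ #Z' + 1`. [folklore: Rolle] -/
theorem card_zeros_monoExt_step (D : ℕ) (c : ι → ℕ → ℝ) (x : ι → ℝ) (v : ℝ) (hD : ∀ i k, D < k → c i k = 0) (A B : ℝ) (Z : Finset ℝ)
    (hZ : ∀ z ∈ Z, z ∈ Set.Icc A B ∧ ∑ i, ∑ k ∈ range (D + 1), c i k * z ^ k * Real.exp (x i * z) = 0) :
    ∃ Z' : Finset ℝ, Z.card ≤ Z'.card + 1 ∧ ∀ z ∈ Z', z ∈ Set.Icc A B ∧
      ∑ i, ∑ k ∈ range (D + 1), (((k : ℝ) + 1) * c i (k + 1) + (x i - v) * c i k) * z ^ k * Real.exp (x i * z) = 0 := by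
  have hderiv := fun t => hasDerivAt_monoExt_twist D c x v hD t
  have hZ1 : ∀ z ∈ Z, z ∈ Set.Icc A B ∧ (fun s => ∑ i, ∑ k ∈ range (D + 1), c i k * s ^ k * Real.exp ((x i - v) * s)) z = 0 :=
    fun z hz => ⟨(hZ z hz).1, by simp only [monoExt_twist_eq, (hZ z hz).2, mul_zero]⟩
  obtain ⟨Z', hcard, hZ'⟩ := rolle_count hderiv A B Z hZ1
  refine ⟨Z', hcard, fun z hz => ⟨(hZ' z hz).1, ?_⟩⟩
  have h := (hZ' z hz).2
  rw [monoExt_twist_eq] at h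
  exact (mul_eq_zero.1 h).resolve_left (Real.exp_pos _).ne'

/-! ## 2. The limit: class regrouping, slot polynomials, zero-free transfer -/

omit [Fintype ι] in
/-- evaluation of the slot polynomial of one index. [bookkeeping] -/
theorem eval_indexPoly (D : ℕ) (c₀ : ι → ℕ → ℝ) (i : ι) (t : ℝ) :
    (∑ k ∈ range (D + 1), C (c₀ i k) * X ^ k).eval t = ∑ k ∈ range (D + 1), c₀ i k * t ^ k := by
  rw [eval_finsetSum]
  exact Finset.sum_congr rfl fun k _ => by rw [eval_mul, eval_C, eval_pow, eval_X]

/-- **class regrouping of the limit**: `Σᵢₖ c₀ i k t^k e^{x₀ᵢt} = Σ_{w ∈ image x₀} (Q w)(t)·e^{wt}`. [folklore] -/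
theorem monoExt_eq_sum_classes [DecidableEq ℝ] (D : ℕ) (c₀ : ι → ℕ → ℝ) (x₀ : ι → ℝ) (Q : ℝ → ℝ[X])
    (hQ : ∀ w, Q w = ∑ i, if x₀ i = w then ∑ k ∈ range (D + 1), C (c₀ i k) * X ^ k else 0) (t : ℝ) :
    ∑ i, ∑ k ∈ range (D + 1), c₀ i k * t ^ k * Real.exp (x₀ i * t) = ∑ w ∈ Finset.univ.image x₀, (Q w).eval t * Real.exp (w * t) := by
  symm
  have hcl : ∀ w, (Q w).eval t * Real.exp (w * t) = ∑ i, if x₀ i = w then (∑ k ∈ range (D + 1), c₀ i k * t ^ k) * Real.exp (w * t) else 0 := by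
    intro w
    rw [hQ, eval_finsetSum, Finset.sum_mul]
    refine Finset.sum_congr rfl fun i _ => ?_
    split_ifs with h
    · rw [eval_indexPoly]
    · rw [eval_zero, zero_mul]
  rw [Finset.sum_congr rfl fun w _ => hcl w, Finset.sum_comm]
  refine Finset.sum_congr rfl fun i _ => ?_
  rw [Finset.sum_ite_eq (Finset.univ.image x₀) (x₀ i), if_pos (Finset.mem_image_of_mem x₀ (Finset.mem_univ i)), Finset.sum_mul]

/-- joint continuity along `ν → ∞`, `t_n → t₀`. [folklore] -/
theorem tendsto_monoExt_comp (D : ℕ) (c : ℕ → ι → ℕ → ℝ) (x : ℕ → ι → ℝ) (c₀ : ι → ℕ → ℝ) (x₀ : ι → ℝ)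
    (hc : ∀ i k, Tendsto (fun ν => c ν i k) atTop (𝓝 (c₀ i k))) (hx : ∀ i, Tendsto (fun ν => x ν i) atTop (𝓝 (x₀ i)))
    {φ : ℕ → ℕ} (hφ : Tendsto φ atTop atTop) {t : ℕ → ℝ} {t₀ : ℝ} (ht : Tendsto t atTop (𝓝 t₀)) :
    Tendsto (fun n => ∑ i, ∑ k ∈ range (D + 1), c (φ n) i k * t n ^ k * Real.exp (x (φ n) i * t n)) atTop
      (𝓝 (∑ i, ∑ k ∈ range (D + 1), c₀ i k * t₀ ^ k * Real.exp (x₀ i * t₀))) := by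
  apply tendsto_finsetSum
  intro i _
  apply tendsto_finsetSum
  intro k _
  have h1 : Tendsto (fun n => c (φ n) i k) atTop (𝓝 (c₀ i k)) := (hc i k).comp hφ
  have h2 : Tendsto (fun n => x (φ n) i) atTop (𝓝 (x₀ i)) := (hx i).comp hφ
  exact (h1.mul (ht.pow k)).mul ((Real.continuous_exp.tendsto _).comp (h2.mul ht))

/-- **zero-free limit ⇒ eventually zero-free** on a compact window (monomial-extended sums). [folklore] -/
theorem eventually_noZero_monoExt (D : ℕ) (c : ℕ → ι → ℕ → ℝ) (x : ℕ → ι → ℝ) (c₀ : ι → ℕ → ℝ) (x₀ : ι → ℝ)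
    (hc : ∀ i k, Tendsto (fun ν => c ν i k) atTop (𝓝 (c₀ i k))) (hx : ∀ i, Tendsto (fun ν => x ν i) atTop (𝓝 (x₀ i)))
    (R : ℝ) (hne : ∀ t ∈ Set.Icc (-R) R, ∑ i, ∑ k ∈ range (D + 1), c₀ i k * t ^ k * Real.exp (x₀ i * t) ≠ 0) :
    ∀ᶠ ν in atTop, ∀ t ∈ Set.Icc (-R) R, ∑ i, ∑ k ∈ range (D + 1), c ν i k * t ^ k * Real.exp (x ν i * t) ≠ 0 := by
  by_contra H
  have H' : ∃ᶠ ν in atTop, ∃ t ∈ Set.Icc (-R) R, ∑ i, ∑ k ∈ range (D + 1), c ν i k * t ^ k * Real.exp (x ν i * t) = 0 := by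
    rw [Filter.not_eventually] at H
    refine H.mono fun ν h => ?_
    by_contra h'
    apply h
    intro t ht h0
    exact h' ⟨t, ht, h0⟩
  obtain ⟨φ, hφ, hφP⟩ := Filter.extraction_of_frequently_atTop H'
  choose t ht h0 using hφP
  obtain ⟨t₀, ht₀, ψ, hψ, hlim⟩ := isCompact_Icc.tendsto_subseq ht
  have hsub : Tendsto (φ ∘ ψ) atTop atTop := (hφ.comp hψ).tendsto_atTop
  have key := tendsto_monoExt_comp D c x c₀ x₀ hc hx hsub hlim
  have key2 : Tendsto (fun _ : ℕ => (0 : ℝ)) atTop (𝓝 (∑ i, ∑ k ∈ range (D + 1), c₀ i k * t₀ ^ k * Real.exp (x₀ i * t₀))) :=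
    key.congr (fun n => h0 (ψ n))
  exact hne t₀ ht₀ (tendsto_const_nhds_iff.mp key2).symm

/-- **slot polynomials of the stepped limit array**: with `c₀′ i k = (k+1)c₀ i (k+1) + (x₀ i − v)c₀ i k` (and `c₀ i k = 0` for `k > D`),
the class polynomial at `w` becomes `(Q w)′ + (w − v)·Q w`. [this file] -/
theorem classPoly_step (D : ℕ) (c₀ : ι → ℕ → ℝ) (x₀ : ι → ℝ) (v : ℝ) (hD : ∀ i k, D < k → c₀ i k = 0) (Q : ℝ → ℝ[X])
    (hQ : ∀ w, Q w = ∑ i, if x₀ i = w then ∑ k ∈ range (D + 1), C (c₀ i k) * X ^ k else 0) (w : ℝ) :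
    (∑ i, if x₀ i = w then ∑ k ∈ range (D + 1), C (((k : ℝ) + 1) * c₀ i (k + 1) + (x₀ i - v) * c₀ i k) * X ^ k else 0) =
      derivative (Q w) + C (w - v) * Q w := by
  rw [hQ, derivative_sum, Finset.mul_sum, ← Finset.sum_add_distrib]
  refine Finset.sum_congr rfl fun i _ => ?_
  split_ifs with h
  · -- one index of the class: reindex the derivative
    rw [h, derivative_sum, Finset.mul_sum, ← Finset.sum_add_distrib]
    have hder : ∑ k ∈ range (D + 1), derivative (C (c₀ i k) * X ^ k) = ∑ k ∈ range (D + 1), C (((k : ℝ) + 1) * c₀ i (k + 1)) * X ^ k := by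
      simp only [derivative_C_mul_X_pow]
      rw [Finset.sum_range_succ' (fun k => C (c₀ i k * (k : ℝ)) * X ^ (k - 1))]
      simp only [Nat.cast_zero, mul_zero, C_0, zero_mul, add_zero, Nat.cast_succ, Nat.add_sub_cancel]
      rw [Finset.sum_range_succ, hD i (D + 1) (by omega), mul_zero, C_0, zero_mul, add_zero]
      exact Finset.sum_congr rfl fun k _ => by rw [mul_comm (c₀ i (k + 1))]
    rw [Finset.sum_add_distrib, hder, ← Finset.sum_add_distrib]
    refine Finset.sum_congr rfl fun k _ => ?_
    rw [C_add, C_mul, C_mul, add_mul]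
    ring
  · rw [derivative_zero, mul_zero, add_zero]

/-- **single constant active class ⇒ eventually zero-free**: if the limit slot polynomials are `Q w₁ = C q` (`q ≠ 0`) and `Q w = 0` otherwise,
the approximants have no zero in the window for large `ν`. [this file] -/
theorem eventually_noZero_of_single_const_class (D : ℕ) (c : ℕ → ι → ℕ → ℝ) (x : ℕ → ι → ℝ) (c₀ : ι → ℕ → ℝ) (x₀ : ι → ℝ)
    (hc : ∀ i k, Tendsto (fun ν => c ν i k) atTop (𝓝 (c₀ i k))) (hx : ∀ i, Tendsto (fun ν => x ν i) atTop (𝓝 (x₀ i)))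
    (Q : ℝ → ℝ[X]) (hQ : ∀ w, Q w = ∑ i, if x₀ i = w then ∑ k ∈ range (D + 1), C (c₀ i k) * X ^ k else 0)
    (w₁ : ℝ) (hw₁ : Q w₁ ≠ 0) (hdeg : (Q w₁).natDegree = 0) (hrest : ∀ w, w ≠ w₁ → Q w = 0) (R : ℝ) :
    ∀ᶠ ν in atTop, ∀ t ∈ Set.Icc (-R) R, ∑ i, ∑ k ∈ range (D + 1), c ν i k * t ^ k * Real.exp (x ν i * t) ≠ 0 := by
  classical
  obtain ⟨q, hq⟩ := natDegree_eq_zero.1 hdeg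
  have hq0 : q ≠ 0 := by rintro rfl; exact hw₁ (by rw [← hq, C_0])
  refine eventually_noZero_monoExt D c x c₀ x₀ hc hx R fun t _ => ?_
  rw [monoExt_eq_sum_classes D c₀ x₀ Q hQ t]
  have hw₁im : w₁ ∈ Finset.univ.image x₀ := by
    by_contra hni
    apply hw₁
    rw [hQ]
    refine Finset.sum_eq_zero fun i _ => ?_
    rw [if_neg]
    intro h
    exact hni (h ▸ Finset.mem_image_of_mem x₀ (Finset.mem_univ i))
  rw [← Finset.add_sum_erase _ _ hw₁im, Finset.sum_eq_zero (fun w hw => by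
    rw [hrest w (Finset.ne_of_mem_erase hw), eval_zero, zero_mul]), add_zero, ← hq, eval_C]
  exact mul_ne_zero hq0 (Real.exp_pos _).ne'

/-! ## 3. The robust extended count -/

/-- **ROBUST LAGUERRE–PÓLYA COUNT.**  Monomial-extended approximants `g_ν(t) = Σᵢ Σ_{k≤D} c ν i k · t^k · e^{x ν i · t}` (arrays vanishing beyond
`D`) with `c ν i k → c₀ i k`, `x ν i → x₀ i`; `Q w` = the limit slot polynomial of the class `w` (indices with `x₀ i = w` merged).  If some `Q w ≠ 0`,
all such `w` lie in `V`, and `Σ_{w ∈ V} [Q w ≠ 0]·(natDegree (Q w) + 1) ≤ N + 1`, then for every window `[−R, R]` and all large `ν`, every finite set of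
zeros of `g_ν` in the window has at most `N` elements. [this file] -/
theorem robust_extSum_count (N : ℕ) :
    ∀ (D : ℕ) (c : ℕ → ι → ℕ → ℝ) (x : ℕ → ι → ℝ) (c₀ : ι → ℕ → ℝ) (x₀ : ι → ℝ) (Q : ℝ → ℝ[X]) (V : Finset ℝ),
      (∀ ν i k, D < k → c ν i k = 0) → (∀ i k, D < k → c₀ i k = 0) →
      (∀ i k, Tendsto (fun ν => c ν i k) atTop (𝓝 (c₀ i k))) → (∀ i, Tendsto (fun ν => x ν i) atTop (𝓝 (x₀ i))) →
      (∀ w, Q w = ∑ i, if x₀ i = w then ∑ k ∈ range (D + 1), C (c₀ i k) * X ^ k else 0) →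
      (∀ w, Q w ≠ 0 → w ∈ V) → (∃ w, Q w ≠ 0) →
      (∑ w ∈ V, if Q w = 0 then 0 else (Q w).natDegree + 1) ≤ N + 1 →
      ∀ R : ℝ, ∀ᶠ ν in atTop, ∀ Z : Finset ℝ,
        (∀ z ∈ Z, z ∈ Set.Icc (-R) R ∧ ∑ i, ∑ k ∈ range (D + 1), c ν i k * z ^ k * Real.exp (x ν i * z) = 0) → Z.card ≤ N := by
  classical
  induction N with
  | zero =>
    intro D c x c₀ x₀ Q V hcD hc₀D hc hx hQ hV hne hslots R
    obtain ⟨w₁, hw₁⟩ := hne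
    have hw₁V := hV w₁ hw₁
    -- exactly one active slot, a non-zero constant
    rw [← Finset.add_sum_erase V _ hw₁V, if_neg hw₁] at hslots
    have hdeg : (Q w₁).natDegree = 0 := by omega
    have hrest : ∀ w, w ≠ w₁ → Q w = 0 := by
      intro w hw
      by_contra h
      have hmem : w ∈ V.erase w₁ := Finset.mem_erase.2 ⟨hw, hV w h⟩
      have h1 : (if Q w = 0 then 0 else (Q w).natDegree + 1) ≤ ∑ w ∈ V.erase w₁, (if Q w = 0 then 0 else (Q w).natDegree + 1) :=
        Finset.single_le_sum (f := fun w => if Q w = 0 then 0 else (Q w).natDegree + 1) (fun _ _ => Nat.zero_le _) hmem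
      rw [if_neg h] at h1
      omega
    filter_upwards [eventually_noZero_of_single_const_class D c x c₀ x₀ hc hx Q hQ w₁ hw₁ hdeg hrest R] with ν hν Z hZ
    rw [Nat.le_zero, Finset.card_eq_zero, Finset.eq_empty_iff_forall_notMem]
    intro z hz
    exact hν z (hZ z hz).1 (hZ z hz).2
  | succ N ih =>
    intro D c x c₀ x₀ Q V hcD hc₀D hc hx hQ hV hne hslots R
    obtain ⟨w₁, hw₁⟩ := hne
    have hw₁V := hV w₁ hw₁
    -- the stepped arrays (twist at the ACTIVE limit class `w₁`)
    set c' : ℕ → ι → ℕ → ℝ := fun ν i k => ((k : ℝ) + 1) * c ν i (k + 1) + (x ν i - w₁) * c ν i k with hc'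
    set c₀' : ι → ℕ → ℝ := fun i k => ((k : ℝ) + 1) * c₀ i (k + 1) + (x₀ i - w₁) * c₀ i k with hc₀'
    set Q' : ℝ → ℝ[X] := fun w => derivative (Q w) + C (w - w₁) * Q w with hQ'
    have hcD' : ∀ ν i k, D < k → c' ν i k = 0 := by
      intro ν i k hk; simp only [hc', hcD ν i k hk, hcD ν i (k + 1) (by omega), mul_zero, add_zero]
    have hc₀D' : ∀ i k, D < k → c₀' i k = 0 := by
      intro i k hk; simp only [hc₀', hc₀D i k hk, hc₀D i (k + 1) (by omega), mul_zero, add_zero]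
    have hc't : ∀ i k, Tendsto (fun ν => c' ν i k) atTop (𝓝 (c₀' i k)) := by
      intro i k
      exact ((hc i (k + 1)).const_mul _).add (((hx i).sub_const w₁).mul (hc i k))
    have hQ'def : ∀ w, Q' w = ∑ i, if x₀ i = w then ∑ k ∈ range (D + 1), C (c₀' i k) * X ^ k else 0 := by
      intro w
      rw [hQ']
      exact (classPoly_step D c₀ x₀ w₁ hc₀D Q hQ w).symm
    -- slot bookkeeping: the count drops by one, an active class survives
    have hle : ∀ w, (if Q' w = 0 then 0 else (Q' w).natDegree + 1) ≤ (if Q w = 0 then 0 else (Q w).natDegree + 1) := by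
      intro w
      by_cases hQw : Q w = 0
      · simp [hQ', hQw]
      · rw [if_neg hQw]
        by_cases hww : w = w₁
        · subst hww
          simp only [hQ', sub_self, C_0, zero_mul, add_zero]
          have := slots_derivative_lt (Q w)
          omega
        · obtain ⟨hne0, hdeg⟩ := natDegree_derivative_add_C_mul (Q w) hQw (w - w₁) (sub_ne_zero.2 hww)
          rw [hQ']; simp only []; rw [if_neg hne0, hdeg]
    have hstrict : (if Q' w₁ = 0 then 0 else (Q' w₁).natDegree + 1) + 1 ≤ (if Q w₁ = 0 then 0 else (Q w₁).natDegree + 1) := by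
      simp only [hQ', sub_self, C_0, zero_mul, add_zero]
      rw [if_neg hw₁]
      exact slots_derivative_lt (Q w₁)
    have hV' : ∀ w, Q' w ≠ 0 → w ∈ V := by
      intro w hw
      apply hV w
      intro h0
      apply hw
      simp [hQ', h0]
    have hslots' : ∑ w ∈ V, (if Q' w = 0 then 0 else (Q' w).natDegree + 1) ≤ N + 1 := by
      have h3 : ∑ w ∈ V.erase w₁, (if Q' w = 0 then 0 else (Q' w).natDegree + 1) ≤ ∑ w ∈ V.erase w₁, (if Q w = 0 then 0 else (Q w).natDegree + 1) :=
        Finset.sum_le_sum fun w _ => hle w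
      rw [← Finset.add_sum_erase V _ hw₁V]
      rw [← Finset.add_sum_erase V _ hw₁V] at hslots
      omega
    -- case B: `w₁` is the only active class and `Q w₁` is constant — then the limit is zero-free and there is nothing to count
    by_cases hB : (Q w₁).natDegree = 0 ∧ ∀ w, w ≠ w₁ → Q w = 0
    · filter_upwards [eventually_noZero_of_single_const_class D c x c₀ x₀ hc hx Q hQ w₁ hw₁ hB.1 hB.2 R] with ν hν Z hZ
      have : Z = ∅ := by
        rw [Finset.eq_empty_iff_forall_notMem]
        intro z hz
        exact hν z (hZ z hz).1 (hZ z hz).2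
      rw [this, Finset.card_empty]
      exact Nat.zero_le _
    -- case A: an active class survives the step
    have hne' : ∃ w, Q' w ≠ 0 := by
      by_cases hA : ∀ w, w ≠ w₁ → Q w = 0
      · -- then `deg Q w₁ ≥ 1` and its derivative survives
        have hd : (Q w₁).natDegree ≠ 0 := fun h => hB ⟨h, hA⟩
        refine ⟨w₁, ?_⟩
        simp only [hQ', sub_self, C_0, zero_mul, add_zero]
        intro hder
        exact hd (derivative_eq_zero.1 hder)
      · push Not at hA
        obtain ⟨w₂, hw₂1, hw₂⟩ := hA
        refine ⟨w₂, ?_⟩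
        simp only [hQ']
        exact (natDegree_derivative_add_C_mul (Q w₂) hw₂ (w₂ - w₁) (sub_ne_zero.2 hw₂1)).1
    filter_upwards [ih D c' x c₀' x₀ Q' V hcD' hc₀D' hc't hx hQ'def hV' hne' hslots' R] with ν hν Z hZ
    obtain ⟨Z', hcard, hZ'⟩ := card_zeros_monoExt_step D (c ν) (x ν) w₁ (hcD ν) (-R) R Z hZ
    have := hν Z' hZ'
    omega

end Summit.ValiantsHypothesis.ValiantsHypothesis.Theorems.LacunarySymmetroidMatrixDescartes.WallBubbling.Bubbling
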